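import Mathlib.Analysis.SpecialFunctions.Exp
import Mathlib.Data.Nat.Choose.Central
import Mathlib.Data.Nat.Choose.Sum
import Mathlib.Data.Nat.Factorial.BigOperators
import Mathlib.Algebra.BigOperators.Intervals
import Mathlib.Data.Nat.Sqrt
import HarnessLib

/-!
# A lower bound for the binomial distribution: the tail at `t ≤ n/8` above (below) the mean has
# mass `≥ (1/15)·e^{−16t²/n}` — in particular constant mass at `Θ(√n)` from the mean

Topic `Literature/Probability/Moments` (counting / binomial-sum form, like `BinomialTailCounting`).
Everything in this file is PROVED; no definition, no named fact.

Source, VERBATIM [cite: OliveiraSanthanam2015, Lemma 2.4 (stated and proved in Appendix B, proof of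
Proposition 2.1)] (I. C. Oliveira, R. Santhanam, *Majority is incompressible by AC⁰[p] circuits*,
CCC 2015): "**Lemma 2.4.** For an even integer `n ∈ ℕ`, consider independent random variables
`X₁, …, Xₙ`, where each `Xᵢ` attains values `0` and `1`, each with probability `1/2`. Let
`X = Σ_{i ∈ [n]} Xᵢ`. Then, for any integer `t ∈ [0, n/8]`, `Pr[X ≥ n/2 + t] ≥ (1/15)·e^{−16t²/n}`."
The authors add: "The next lemma follows from more general results presented in Feller [Feller1968].
We follow closely the exposition in Matoušek and Vondrák" (J. Matoušek, J. Vondrák, *The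
probabilistic method*, lecture notes, 2008, Prop. 7.3.2 — the same statement and proof).

PRINTED PROOF (`n = 2m`): `Pr[X ≥ m+t] = 2^{−2m} Σ_{j=t}^{m} C(2m, m+j) ≥ 2^{−2m} Σ_{j=t}^{2t−1} C(2m,m+j)`;
`C(2m, m+j) = C(2m, m)·Π_{i=1}^{j} (m−j+i)/(m+i) = C(2m,m)·Π_{i=1}^{j} (1 − j/(m+i))`;
`C(2m,m) ≥ 2^{2m}/(2√m)`; each product is `≥ (1 − 2t/m)^{2t} ≥ e^{−8t²/m}` (since `1 − x ≥ e^{−2x}`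
for `0 ≤ x ≤ 1/2`); hence `Pr ≥ (t/(2√m))·e^{−8t²/m}`, which is `≥ (1/8)e^{−16t²/n}` when
`t ≥ √m/4`; for `t < √m/4` the probability is at least the one at `√m/4`, `≥ (1/8)e^{−1/2} ≥ 1/15`.

WHAT IS PROVED HERE, and how it maps onto the text.  We count patterns instead of probabilities:
`2ⁿ·Pr[X ≥ n/2 + t] = Σ_{n/2+t ≤ j ≤ n} C(n, j)` and, by the symmetry `x ↦ x̄` of the cube,
`= Σ_{j ≤ n/2 − t} C(n, j)`.
* `binomial_upper_tail_ge` — Lemma 2.4 verbatim (upper tail), `binomial_lower_tail_ge` — the same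
  for the lower tail; both from `binomial_lower_tail_ge_aux` (the statement in the half-length `m`).
  The proof is the printed one, step by step (`choose_sub_mul_ascFactorial` = the product formula,
  `choose_sub_ge` = the ratio bound `(1 − 2t/m)^{2t}`, `exp_neg_two_mul_le` = `e^{−2x} ≤ 1 − x`,
  `sixteen_pow_le_centralBinom_sq` = `C(2m,m) ≥ 4^m/(2√m)`), except in the regime `16t² ≤ m`
  ("`t < √m/4`"), where the printed reduction to `t = √m/4` ignores that `t` is an integer; there we
  use instead the elementary estimate `Σ_{j ≤ m−t} C(2m,j) ≥ 4^m/2 − t·C(2m,m) ≥ 4^m/4` (from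
  `(2m+1)·C(2m,m)² ≤ 16^m`), which gives the printed constant `1/15` with room to spare.
* `binomial_lower_tail_const` — the corollary used downstream (all `n`, odd or even; cell qa-qnc0,
  `BinomTailLower` of the tube-bound programme): for every `C` there are `c > 0`, `m₀` with
  `c·2^m ≤ Σ_{j ≤ ⌊m/2⌋ − t} C(m, j)` whenever `m ≥ m₀`, `t ≤ C·⌊√m⌋` (`c = e^{−32C²}/30`, `m₀ = (8C+1)²`).

## References
* [OliveiraSanthanam2015] I. C. Oliveira, R. Santhanam, *Majority is incompressible by AC⁰[p]
  circuits*, 30th CCC, LIPIcs 33 (2015), 124–157; full version Appendix B, Lemma 2.4 (galaxy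
  pdf:4332111960, pp. 42–43).
* [Feller1968] W. Feller, *An introduction to probability theory and its applications* I, 3rd ed.,
  Wiley 1968, Ch. VII (normal approximation to the binomial distribution).
* J. Matoušek, J. Vondrák, *The probabilistic method* (lecture notes, KAM–DIMATIA / ETH, 2008), §7.3,
  Proposition 7.3.2.
-/

open Finset

noncomputable section

namespace Literature.Probability.Moments

/-! ### Integer lemmas: the central binomial coefficient and the lower half of a row -/

/-- `(2m+1)·C(2m,m)² ≤ 16^m`, i.e. `C(2m,m) ≤ 4^m/√(2m+1)` (induction on `m` with
`(m+1)·C(2m+2,m+1) = 2(2m+1)·C(2m,m)`; the tree also has this as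
`Literature.Computability.MetaComplexity.Smolensky.succ_mul_centralBinom_sq_le`, re-proved here to keep the
imports of this file inside Mathlib). [folklore] -/
private theorem succ_mul_centralBinom_sq_le (m : ℕ) :
    (2 * m + 1) * Nat.centralBinom m ^ 2 ≤ 16 ^ m := by
  induction m with
  | zero => simp [Nat.centralBinom_zero]
  | succ m ih =>
    have hrec := Nat.succ_mul_centralBinom_succ m
    have key : (m + 1) ^ 2 * ((2 * (m + 1) + 1) * Nat.centralBinom (m + 1) ^ 2) ≤
        (m + 1) ^ 2 * 16 ^ (m + 1) := by
      calc (m + 1) ^ 2 * ((2 * (m + 1) + 1) * Nat.centralBinom (m + 1) ^ 2)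
          = (2 * m + 3) * ((m + 1) * Nat.centralBinom (m + 1)) ^ 2 := by ring
        _ = (2 * m + 3) * (2 * (2 * m + 1) * Nat.centralBinom m) ^ 2 := by rw [hrec]
        _ = 4 * (2 * m + 1) * (2 * m + 3) * ((2 * m + 1) * Nat.centralBinom m ^ 2) := by ring
        _ ≤ 4 * (2 * m + 1) * (2 * m + 3) * 16 ^ m := Nat.mul_le_mul_left _ ih
        _ ≤ 16 * (m + 1) ^ 2 * 16 ^ m := by
            apply Nat.mul_le_mul_right
            nlinarith
        _ = (m + 1) ^ 2 * 16 ^ (m + 1) := by ring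
    exact Nat.le_of_mul_le_mul_left key (by positivity)

/-- `16^m ≤ 4m·C(2m,m)²` for `m ≥ 1`, i.e. `C(2m,m) ≥ 4^m/(2√m) = 2^{2m}/(2√m)` — the central
binomial estimate quoted in the printed proof. [folklore] -/
private theorem sixteen_pow_le_centralBinom_sq (m : ℕ) (hm : 1 ≤ m) :
    16 ^ m ≤ 4 * m * Nat.centralBinom m ^ 2 := by
  induction m, hm using Nat.le_induction with
  | base => decide
  | succ m hm ih =>
    have hrec := Nat.succ_mul_centralBinom_succ m
    have key : (m + 1) * 16 ^ (m + 1) ≤ (m + 1) * (4 * (m + 1) * Nat.centralBinom (m + 1) ^ 2) := by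
      calc (m + 1) * 16 ^ (m + 1) = 16 * (m + 1) * 16 ^ m := by ring
        _ ≤ 16 * (m + 1) * (4 * m * Nat.centralBinom m ^ 2) := Nat.mul_le_mul_left _ ih
        _ = 64 * (m * (m + 1)) * Nat.centralBinom m ^ 2 := by ring
        _ ≤ 16 * (2 * m + 1) ^ 2 * Nat.centralBinom m ^ 2 := by
            apply Nat.mul_le_mul_right
            nlinarith
        _ = 4 * (2 * (2 * m + 1) * Nat.centralBinom m) ^ 2 := by ring
        _ = 4 * ((m + 1) * Nat.centralBinom (m + 1)) ^ 2 := by rw [hrec]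
        _ = (m + 1) * (4 * (m + 1) * Nat.centralBinom (m + 1) ^ 2) := by ring
    exact Nat.le_of_mul_le_mul_left key (by positivity)

/-- The lower half of row `2m` of Pascal's triangle carries at least half of its mass:
`4^m ≤ 2·Σ_{j ≤ m} C(2m, j)` (symmetry `C(2m, j) = C(2m, 2m−j)`). [folklore] -/
private theorem four_pow_le_two_mul_sum_half (m : ℕ) :
    4 ^ m ≤ 2 * ∑ j ∈ range (m + 1), (2 * m).choose j := by
  have htot : ∑ j ∈ range (2 * m + 1), (2 * m).choose j = 4 ^ m := by
    rw [Nat.sum_range_choose, pow_mul]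
    norm_num
  have hsplit : ∑ j ∈ range (m + 1), (2 * m).choose j + ∑ j ∈ Ico (m + 1) (2 * m + 1), (2 * m).choose j
      = ∑ j ∈ range (2 * m + 1), (2 * m).choose j :=
    Finset.sum_range_add_sum_Ico _ (by omega)
  have hup : ∑ j ∈ Ico (m + 1) (2 * m + 1), (2 * m).choose j = ∑ k ∈ range m, (2 * m).choose k := by
    rw [Finset.sum_Ico_eq_sum_range]
    have e : 2 * m + 1 - (m + 1) = m := by omega
    rw [e, ← Finset.sum_range_reflect (fun k => (2 * m).choose k) m]
    refine Finset.sum_congr rfl fun k hk => ?_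
    rw [Finset.mem_range] at hk
    rw [← Nat.choose_symm (show m + 1 + k ≤ 2 * m by omega)]
    congr 1
    omega
  have hle : ∑ k ∈ range m, (2 * m).choose k ≤ ∑ j ∈ range (m + 1), (2 * m).choose j := by
    rw [Finset.sum_range_succ]
    exact Nat.le_add_right _ _
  omega

/-- Reflection `j ↦ n − j`: `Σ_{j ≤ a} C(n, j) = Σ_{n−a ≤ j ≤ n} C(n, j)` (`a ≤ n`). [folklore] -/
private theorem sum_range_choose_reflect (n a : ℕ) (ha : a ≤ n) :
    ∑ j ∈ range (a + 1), n.choose j = ∑ j ∈ Ico (n - a) (n + 1), n.choose j := by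
  rw [Finset.sum_Ico_eq_sum_range]
  have e : n + 1 - (n - a) = a + 1 := by omega
  rw [e, ← Finset.sum_range_reflect (fun j => n.choose j) (a + 1)]
  refine Finset.sum_congr rfl fun j hj => ?_
  rw [Finset.mem_range] at hj
  rw [← Nat.choose_symm (show a + 1 - 1 - j ≤ n by omega)]
  congr 1
  omega

/-- The product formula of the printed proof, cleared of denominators:
`C(2m, m−j)·(m+1)(m+2)⋯(m+j) = C(2m, m)·(m−j+1)(m−j+2)⋯m` (`j ≤ m`; note `C(2m,m−j) = C(2m,m+j)`). [folklore] -/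
private theorem choose_sub_mul_ascFactorial {m j : ℕ} (hj : j ≤ m) :
    (2 * m).choose (m - j) * (m + 1).ascFactorial j =
      Nat.centralBinom m * (m - j + 1).ascFactorial j := by
  have h1 := Nat.choose_mul_factorial_mul_factorial (show m - j ≤ 2 * m by omega)
  have h2 := Nat.choose_mul_factorial_mul_factorial (show m ≤ 2 * m by omega)
  have e1 : 2 * m - (m - j) = m + j := by omega
  have e2 : 2 * m - m = m := by omega
  rw [e1] at h1
  rw [e2] at h2
  have hA := Nat.factorial_mul_ascFactorial m j
  have hB := Nat.factorial_mul_ascFactorial (m - j) j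
  rw [Nat.sub_add_cancel hj] at hB
  have hpos : 0 < (m - j).factorial * m.factorial := by positivity
  apply Nat.eq_of_mul_eq_mul_left hpos
  rw [Nat.centralBinom_eq_two_mul_choose]
  calc (m - j).factorial * m.factorial * ((2 * m).choose (m - j) * (m + 1).ascFactorial j)
      = (2 * m).choose (m - j) * (m - j).factorial * (m.factorial * (m + 1).ascFactorial j) := by ring
    _ = (2 * m).factorial := by rw [hA, h1]
    _ = (2 * m).choose m * m.factorial * m.factorial := h2.symm
    _ = (2 * m).choose m * m.factorial * ((m - j).factorial * (m - j + 1).ascFactorial j) := by rw [hB]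
    _ = (m - j).factorial * m.factorial * ((2 * m).choose m * (m - j + 1).ascFactorial j) := by ring

/-! ### Real lemmas -/

/-- `e^{−2x} ≤ 1 − x` for `0 ≤ x ≤ 1/2` (from `1 + 2x ≤ e^{2x}` and `(1 − x)(1 + 2x) ≥ 1`). [folklore] -/
private theorem exp_neg_two_mul_le {x : ℝ} (hx0 : 0 ≤ x) (hx1 : x ≤ 1 / 2) :
    Real.exp (-(2 * x)) ≤ 1 - x := by
  have h1 : (1 : ℝ) ≤ (1 - x) * Real.exp (2 * x) := by
    have he : 1 + 2 * x ≤ Real.exp (2 * x) := by linarith [Real.add_one_le_exp (2 * x)]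
    have h1x : 0 ≤ 1 - x := by linarith
    calc (1 : ℝ) ≤ (1 - x) * (1 + 2 * x) := by nlinarith
      _ ≤ (1 - x) * Real.exp (2 * x) := mul_le_mul_of_nonneg_left he h1x
  calc Real.exp (-(2 * x)) = Real.exp (-(2 * x)) * 1 := (mul_one _).symm
    _ ≤ Real.exp (-(2 * x)) * ((1 - x) * Real.exp (2 * x)) :=
        mul_le_mul_of_nonneg_left h1 (Real.exp_pos _).le
    _ = (1 - x) * (Real.exp (-(2 * x)) * Real.exp (2 * x)) := by ring
    _ = 1 - x := by rw [← Real.exp_add, neg_add_cancel, Real.exp_zero, mul_one]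

/-- The ratio bound of the printed proof: for `j ≤ 2t`, `4t ≤ m`,
`C(2m, m−j) ≥ C(2m, m)·(1 − 2t/m)^{2t}` (each factor `(m−j+i)/(m+i) = 1 − j/(m+i) ≥ 1 − 2t/m`). [folklore] -/
private theorem choose_sub_ge (m t j : ℕ) (ht : 4 * t ≤ m) (hj : j ≤ 2 * t) :
    (Nat.centralBinom m : ℝ) * (1 - 2 * t / m) ^ (2 * t) ≤ ((2 * m).choose (m - j) : ℝ) := by
  have hjm : j ≤ m := by omega
  rcases Nat.eq_zero_or_pos t with ht0 | htpos
  · subst ht0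
    have hj0 : j = 0 := by omega
    subst hj0
    simp [Nat.centralBinom_eq_two_mul_choose]
  have hmpos : 0 < m := by omega
  have hm : (0 : ℝ) < m := by exact_mod_cast hmpos
  have hq0 : (0 : ℝ) ≤ 1 - 2 * t / m := by
    rw [sub_nonneg, div_le_one hm]
    have : ((2 * t : ℕ) : ℝ) ≤ m := by exact_mod_cast (by omega : 2 * t ≤ m)
    push_cast at this
    exact this
  have hq1 : (1 - 2 * t / m : ℝ) ≤ 1 := by
    have : (0 : ℝ) ≤ 2 * t / m := by positivity
    linarith
  have hid := choose_sub_mul_ascFactorial hjm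
  rw [Nat.ascFactorial_eq_prod_range, Nat.ascFactorial_eq_prod_range] at hid
  have hidR : ((2 * m).choose (m - j) : ℝ) * ∏ i ∈ range j, ((m : ℝ) + 1 + i) =
      (Nat.centralBinom m : ℝ) * ∏ i ∈ range j, ((m : ℝ) - j + 1 + i) := by
    have := congrArg (Nat.cast : ℕ → ℝ) hid
    push_cast [Nat.cast_sub hjm] at this
    exact this
  have hApos : (0 : ℝ) < ∏ i ∈ range j, ((m : ℝ) + 1 + i) := prod_pos fun i _ => by positivity
  have hprod : (1 - 2 * t / m : ℝ) ^ (2 * t) * ∏ i ∈ range j, ((m : ℝ) + 1 + i) ≤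
      ∏ i ∈ range j, ((m : ℝ) - j + 1 + i) := by
    have hjt : (1 - 2 * t / m : ℝ) ^ (2 * t) ≤ (1 - 2 * t / m) ^ j := pow_le_pow_of_le_one hq0 hq1 hj
    calc (1 - 2 * t / m : ℝ) ^ (2 * t) * ∏ i ∈ range j, ((m : ℝ) + 1 + i)
        ≤ (1 - 2 * t / m) ^ j * ∏ i ∈ range j, ((m : ℝ) + 1 + i) :=
          mul_le_mul_of_nonneg_right hjt hApos.le
      _ = ∏ i ∈ range j, ((1 - 2 * t / m) * ((m : ℝ) + 1 + i)) := by
          rw [prod_mul_distrib, prod_const, card_range]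
      _ ≤ ∏ i ∈ range j, ((m : ℝ) - j + 1 + i) := by
          apply prod_le_prod
          · intro i _
            exact mul_nonneg hq0 (by positivity)
          · intro i _
            have hjR : (j : ℝ) ≤ 2 * t := by exact_mod_cast hj
            have h1 : (2 * t : ℝ) ≤ 2 * t / m * ((m : ℝ) + 1 + i) := by
              rw [div_mul_eq_mul_div, le_div_iff₀ hm]
              nlinarith
            nlinarith
  have h2 : (Nat.centralBinom m : ℝ) * (1 - 2 * t / m) ^ (2 * t) * ∏ i ∈ range j, ((m : ℝ) + 1 + i)
      ≤ ((2 * m).choose (m - j) : ℝ) * ∏ i ∈ range j, ((m : ℝ) + 1 + i) := by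
    rw [hidR, mul_assoc]
    exact mul_le_mul_of_nonneg_left hprod (by positivity)
  exact le_of_mul_le_mul_right h2 hApos

/-! ### Lemma 2.4 -/

/-- Lemma 2.4 in the half-length `m` (`n = 2m`), lower-tail form: for `4t ≤ m`,
`(1/15)·e^{−8t²/m}·4^m ≤ Σ_{j ≤ m−t} C(2m, j)` (`= 2^{2m}·Pr[X ≤ m − t] = 2^{2m}·Pr[X ≥ m + t]`).
[cite: OliveiraSanthanam2015, Lemma 2.4] -/
theorem binomial_lower_tail_ge_aux (m t : ℕ) (ht : 4 * t ≤ m) :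
    (1 / 15 : ℝ) * Real.exp (-(8 * (t : ℝ) ^ 2 / m)) * 4 ^ m ≤
      ∑ j ∈ range (m - t + 1), ((2 * m).choose j : ℝ) := by
  have hE1 : Real.exp (-(8 * (t : ℝ) ^ 2 / m)) ≤ 1 := by
    rw [Real.exp_le_one_iff]
    have : (0 : ℝ) ≤ 8 * (t : ℝ) ^ 2 / m := by positivity
    linarith
  have h4m : (0 : ℝ) ≤ (4 : ℝ) ^ m := by positivity
  by_cases hsmall : 16 * t ^ 2 ≤ m
  · -- the regime `t ≤ √m/4`: `Σ_{j ≤ m−t} C(2m,j) ≥ 4^m/2 − t·C(2m,m) ≥ 4^m/4`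
    have h1 := four_pow_le_two_mul_sum_half m
    have h2 : ∑ j ∈ range (m - t + 1), (2 * m).choose j +
        ∑ j ∈ Ico (m - t + 1) (m + 1), (2 * m).choose j = ∑ j ∈ range (m + 1), (2 * m).choose j :=
      Finset.sum_range_add_sum_Ico _ (by omega)
    have h3 : ∑ j ∈ Ico (m - t + 1) (m + 1), (2 * m).choose j ≤ t * Nat.centralBinom m := by
      have := Finset.sum_le_card_nsmul (Ico (m - t + 1) (m + 1)) (fun j => (2 * m).choose j)
        (Nat.centralBinom m) (fun j _ => Nat.choose_le_centralBinom j m)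
      rw [Nat.card_Ico, smul_eq_mul] at this
      have e : m + 1 - (m - t + 1) = t := by omega
      rw [e] at this
      exact this
    have h4 : 4 * (t * Nat.centralBinom m) ≤ 4 ^ m := by
      have h5 := succ_mul_centralBinom_sq_le m
      have h6 : (4 * (t * Nat.centralBinom m)) ^ 2 ≤ (4 ^ m) ^ 2 := by
        calc (4 * (t * Nat.centralBinom m)) ^ 2 = 16 * t ^ 2 * Nat.centralBinom m ^ 2 := by ring
          _ ≤ m * Nat.centralBinom m ^ 2 := Nat.mul_le_mul_right _ hsmall
          _ ≤ (2 * m + 1) * Nat.centralBinom m ^ 2 := Nat.mul_le_mul_right _ (by omega)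
          _ ≤ 16 ^ m := h5
          _ = (4 ^ m) ^ 2 := by rw [← pow_mul, mul_comm, pow_mul]; norm_num
      exact (Nat.pow_le_pow_iff_left (by norm_num)).mp h6
    have hN : 4 ^ m ≤ 4 * ∑ j ∈ range (m - t + 1), (2 * m).choose j := by omega
    have hR : (4 : ℝ) ^ m ≤ 4 * ∑ j ∈ range (m - t + 1), ((2 * m).choose j : ℝ) := by
      exact_mod_cast hN
    nlinarith [mul_le_mul_of_nonneg_right hE1 h4m]
  · -- the regime `t > √m/4` (so `t ≥ 1`, `m ≥ 4`): the printed chain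
    push Not at hsmall
    have ht1 : 1 ≤ t := by
      rcases Nat.eq_zero_or_pos t with h | h
      · subst h
        simp at hsmall
      · exact h
    have hm4 : 4 ≤ m := by omega
    have hm : (0 : ℝ) < m := by exact_mod_cast (by omega : 0 < m)
    -- keep only the `t` terms `j = m − j'`, `t ≤ j' ≤ 2t − 1`
    have hsub : ∑ j ∈ Ico (m - 2 * t + 1) (m - t + 1), (2 * m).choose j ≤
        ∑ j ∈ range (m - t + 1), (2 * m).choose j := by
      rw [Finset.range_eq_Ico]
      exact Finset.sum_le_sum_of_subset (Finset.Ico_subset_Ico (by omega) le_rfl)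
    have hsubR : ∑ j ∈ Ico (m - 2 * t + 1) (m - t + 1), ((2 * m).choose j : ℝ) ≤
        ∑ j ∈ range (m - t + 1), ((2 * m).choose j : ℝ) := by
      exact_mod_cast hsub
    -- `(1 − 2t/m)^{2t} ≥ e^{−8t²/m}`
    have hqE : Real.exp (-(8 * (t : ℝ) ^ 2 / m)) ≤ (1 - 2 * t / m : ℝ) ^ (2 * t) := by
      have hx0 : (0 : ℝ) ≤ 2 * t / m := by positivity
      have hx1 : (2 * t / m : ℝ) ≤ 1 / 2 := by
        rw [div_le_iff₀ hm]
        have : ((4 * t : ℕ) : ℝ) ≤ m := by exact_mod_cast ht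
        push_cast at this
        linarith
      have h1 := exp_neg_two_mul_le hx0 hx1
      have h2 : Real.exp (-(8 * (t : ℝ) ^ 2 / m)) = Real.exp (-(2 * (2 * t / m))) ^ (2 * t) := by
        rw [← Real.exp_nat_mul]
        congr 1
        push_cast
        ring
      rw [h2]
      exact pow_le_pow_left₀ (Real.exp_pos _).le h1 _
    -- each of the `t` terms is `≥ C(2m,m)·(1 − 2t/m)^{2t}`
    have hterm : ∀ j ∈ Ico (m - 2 * t + 1) (m - t + 1),
        (Nat.centralBinom m : ℝ) * (1 - 2 * t / m) ^ (2 * t) ≤ ((2 * m).choose j : ℝ) := by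
      intro j hj
      rw [Finset.mem_Ico] at hj
      obtain ⟨j', hj'1, hj'2⟩ : ∃ j', j' ≤ 2 * t ∧ j = m - j' := ⟨m - j, by omega, by omega⟩
      rw [hj'2]
      exact choose_sub_ge m t j' ht hj'1
    have hsum : (t : ℝ) * ((Nat.centralBinom m : ℝ) * (1 - 2 * t / m) ^ (2 * t)) ≤
        ∑ j ∈ Ico (m - 2 * t + 1) (m - t + 1), ((2 * m).choose j : ℝ) := by
      have := Finset.card_nsmul_le_sum (Ico (m - 2 * t + 1) (m - t + 1))
        (fun j => ((2 * m).choose j : ℝ)) _ hterm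
      rw [Nat.card_Ico, nsmul_eq_mul] at this
      have e : m - t + 1 - (m - 2 * t + 1) = t := by omega
      rw [e] at this
      exact this
    -- `C(2m,m) ≥ 4^m/(2√m)` and `4t ≥ √m`: `8t·C(2m,m) ≥ 4^m`
    have hcb : (4 : ℝ) ^ m ≤ 8 * t * Nat.centralBinom m := by
      have h1 := sixteen_pow_le_centralBinom_sq m (by omega)
      have h2 : (16 : ℝ) ^ m ≤ 4 * m * (Nat.centralBinom m : ℝ) ^ 2 := by exact_mod_cast h1
      have h3 : (m : ℝ) ≤ 16 * (t : ℝ) ^ 2 := by exact_mod_cast hsmall.le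
      have hcb0 : (0 : ℝ) ≤ (Nat.centralBinom m : ℝ) ^ 2 := by positivity
      have h4 : ((4 : ℝ) ^ m) ^ 2 ≤ (8 * t * Nat.centralBinom m) ^ 2 := by
        calc ((4 : ℝ) ^ m) ^ 2 = 16 ^ m := by rw [← pow_mul, mul_comm, pow_mul]; norm_num
          _ ≤ 4 * m * (Nat.centralBinom m : ℝ) ^ 2 := h2
          _ ≤ 4 * (16 * (t : ℝ) ^ 2) * (Nat.centralBinom m : ℝ) ^ 2 := by
              nlinarith [mul_le_mul_of_nonneg_right h3 hcb0]
          _ = (8 * t * Nat.centralBinom m) ^ 2 := by ring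
      exact (pow_le_pow_iff_left₀ h4m (by positivity) two_ne_zero).mp h4
    calc (1 / 15 : ℝ) * Real.exp (-(8 * (t : ℝ) ^ 2 / m)) * 4 ^ m
        ≤ (1 / 8) * Real.exp (-(8 * (t : ℝ) ^ 2 / m)) * (8 * t * Nat.centralBinom m) := by
          have : (1 / 15 : ℝ) * Real.exp (-(8 * (t : ℝ) ^ 2 / m)) ≤
              (1 / 8) * Real.exp (-(8 * (t : ℝ) ^ 2 / m)) := by
            nlinarith [Real.exp_pos (-(8 * (t : ℝ) ^ 2 / m))]
          exact mul_le_mul this hcb h4m (by positivity)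
      _ = (t : ℝ) * ((Nat.centralBinom m : ℝ) * Real.exp (-(8 * (t : ℝ) ^ 2 / m))) := by ring
      _ ≤ (t : ℝ) * ((Nat.centralBinom m : ℝ) * (1 - 2 * t / m) ^ (2 * t)) := by
          apply mul_le_mul_of_nonneg_left _ (by positivity)
          exact mul_le_mul_of_nonneg_left hqE (by positivity)
      _ ≤ ∑ j ∈ Ico (m - 2 * t + 1) (m - t + 1), ((2 * m).choose j : ℝ) := hsum
      _ ≤ ∑ j ∈ range (m - t + 1), ((2 * m).choose j : ℝ) := hsubR

/-- **[OliveiraSanthanam2015, Lemma 2.4]** (after Matoušek–Vondrák, Prop. 7.3.2, and Feller), VERBATIM in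
counting form: for an even `n` and an integer `t ∈ [0, n/8]`, if `X` is the number of ones of a uniformly
random `x ∈ {0,1}ⁿ` (a sum of `n` independent fair `0/1` variables) then `Pr[X ≥ n/2 + t] ≥ (1/15)·e^{−16t²/n}`,
i.e. `(1/15)·e^{−16t²/n}·2ⁿ ≤ #{x : |x| ≥ n/2 + t} = Σ_{n/2+t ≤ j ≤ n} C(n, j)`.
[cite: OliveiraSanthanam2015, Lemma 2.4] -/
theorem binomial_upper_tail_ge {n : ℕ} (hn : Even n) (t : ℕ) (ht : 8 * t ≤ n) :
    (1 / 15 : ℝ) * Real.exp (-(16 * (t : ℝ) ^ 2 / n)) * 2 ^ n ≤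
      ∑ j ∈ Ico (n / 2 + t) (n + 1), (n.choose j : ℝ) := by
  obtain ⟨m, rfl⟩ := hn
  have hm2 : (m + m) / 2 = m := by omega
  have e2m : m + m = 2 * m := by ring
  rw [hm2, e2m]
  have key := binomial_lower_tail_ge_aux m t (by omega)
  have hrefl := sum_range_choose_reflect (2 * m) (m - t) (by omega)
  have e3 : 2 * m - (m - t) = m + t := by omega
  rw [e3] at hrefl
  have hreflR : ∑ j ∈ range (m - t + 1), ((2 * m).choose j : ℝ) =
      ∑ j ∈ Ico (m + t) (2 * m + 1), ((2 * m).choose j : ℝ) := by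
    exact_mod_cast hrefl
  have hexp : Real.exp (-(16 * (t : ℝ) ^ 2 / ((2 * m : ℕ) : ℝ))) = Real.exp (-(8 * (t : ℝ) ^ 2 / m)) := by
    congr 1
    push_cast
    ring
  have hpow : (2 : ℝ) ^ (2 * m) = 4 ^ m := by
    rw [pow_mul]
    norm_num
  rw [← hreflR, hexp, hpow]
  exact key

/-- **[OliveiraSanthanam2015, Lemma 2.4], lower-tail form** (the symmetry `x ↦ x̄` of the cube exchanges
`X ≥ n/2 + t` and `X ≤ n/2 − t`): for even `n` and `8t ≤ n`,
`(1/15)·e^{−16t²/n}·2ⁿ ≤ #{x : |x| ≤ n/2 − t} = Σ_{j ≤ n/2 − t} C(n, j)`.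
[cite: OliveiraSanthanam2015, Lemma 2.4] -/
theorem binomial_lower_tail_ge {n : ℕ} (hn : Even n) (t : ℕ) (ht : 8 * t ≤ n) :
    (1 / 15 : ℝ) * Real.exp (-(16 * (t : ℝ) ^ 2 / n)) * 2 ^ n ≤
      ∑ j ∈ range (n / 2 - t + 1), (n.choose j : ℝ) := by
  obtain ⟨m, rfl⟩ := hn
  have hm2 : (m + m) / 2 = m := by omega
  have e2m : m + m = 2 * m := by ring
  rw [hm2, e2m]
  have key := binomial_lower_tail_ge_aux m t (by omega)
  have hexp : Real.exp (-(16 * (t : ℝ) ^ 2 / ((2 * m : ℕ) : ℝ))) = Real.exp (-(8 * (t : ℝ) ^ 2 / m)) := by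
    congr 1
    push_cast
    ring
  have hpow : (2 : ℝ) ^ (2 * m) = 4 ^ m := by
    rw [pow_mul]
    norm_num
  rw [hexp, hpow]
  exact key

/-- **Constant mass of the binomial lower tail at `C√m` below the mean** (corollary of
[OliveiraSanthanam2015, Lemma 2.4], for all `m`, odd or even — an odd row dominates the even row below it
termwise): for every `C` there are `c > 0` and `m₀` such that
`c·2^m ≤ Σ_{j ≤ ⌊m/2⌋ − t} C(m, j) = #{x ∈ {0,1}^m : |x| ≤ ⌊m/2⌋ − t}` for all `m ≥ m₀` and all
`t ≤ C·⌊√m⌋`; explicitly `c = e^{−32C²}/30`, `m₀ = (8C+1)²`.  (This is the shape `BinomTailLower` consumed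
by the tube-bound programme of cell qa-qnc0.) [cite: OliveiraSanthanam2015, Lemma 2.4] -/
theorem binomial_lower_tail_const (C : ℕ) :
    ∃ c : ℝ, 0 < c ∧ ∃ m₀ : ℕ, ∀ m ≥ m₀, ∀ t : ℕ, t ≤ C * Nat.sqrt m →
      c * (2 : ℝ) ^ m ≤ ∑ j ∈ range (m / 2 - t + 1), (m.choose j : ℝ) := by
  refine ⟨Real.exp (-(32 * (C : ℝ) ^ 2)) / 30, by positivity, (8 * C + 1) ^ 2, fun m hm t ht => ?_⟩
  have hss : Nat.sqrt m * Nat.sqrt m ≤ m := Nat.sqrt_le m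
  have hs1 : 8 * C + 1 ≤ Nat.sqrt m := by
    rw [Nat.le_sqrt, ← pow_two]
    exact hm
  have hm'2 : 2 * (m / 2) ≤ m := by omega
  have hm'3 : m ≤ 2 * (m / 2) + 1 := by omega
  have h4t : 4 * t ≤ m / 2 := by
    have h1 : 8 * (C * Nat.sqrt m) + Nat.sqrt m ≤ Nat.sqrt m * Nat.sqrt m := by
      nlinarith [Nat.mul_le_mul_right (Nat.sqrt m) hs1]
    omega
  have hrow : ∑ j ∈ range (m / 2 - t + 1), ((2 * (m / 2)).choose j : ℝ) ≤
      ∑ j ∈ range (m / 2 - t + 1), (m.choose j : ℝ) := by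
    apply Finset.sum_le_sum
    intro j _
    exact_mod_cast Nat.choose_le_choose j hm'2
  have key := binomial_lower_tail_ge_aux (m / 2) t h4t
  have hexp : Real.exp (-(32 * (C : ℝ) ^ 2)) ≤ Real.exp (-(8 * (t : ℝ) ^ 2 / ((m / 2 : ℕ) : ℝ))) := by
    rw [Real.exp_le_exp, neg_le_neg_iff]
    rcases Nat.eq_zero_or_pos (m / 2) with h0 | hpos
    · have ht0 : t = 0 := by omega
      rw [ht0]
      simp
    · have hm'R : (0 : ℝ) < ((m / 2 : ℕ) : ℝ) := by exact_mod_cast hpos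
      have hm'1 : (1 : ℝ) ≤ ((m / 2 : ℕ) : ℝ) := by exact_mod_cast hpos
      have htR : (t : ℝ) ≤ C * Nat.sqrt m := by exact_mod_cast ht
      have hsR : ((Nat.sqrt m : ℕ) : ℝ) ^ 2 ≤ m := by exact_mod_cast Nat.sqrt_le' m
      have hmR : (m : ℝ) ≤ 2 * ((m / 2 : ℕ) : ℝ) + 1 := by exact_mod_cast hm'3
      rw [div_le_iff₀ hm'R]
      have h1 : (t : ℝ) ^ 2 ≤ (C : ℝ) ^ 2 * ((Nat.sqrt m : ℕ) : ℝ) ^ 2 := by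
        rw [← mul_pow]
        exact pow_le_pow_left₀ (by positivity) htR 2
      nlinarith [mul_le_mul_of_nonneg_left hsR (sq_nonneg (C : ℝ)),
        mul_le_mul_of_nonneg_left hmR (sq_nonneg (C : ℝ)),
        mul_le_mul_of_nonneg_left hm'1 (sq_nonneg (C : ℝ))]
  have hpow : (2 : ℝ) ^ m ≤ 2 * 4 ^ (m / 2) := by
    calc (2 : ℝ) ^ m ≤ 2 ^ (2 * (m / 2) + 1) := pow_le_pow_right₀ (by norm_num) hm'3
      _ = 2 * 4 ^ (m / 2) := by rw [pow_succ, pow_mul]; norm_num; ring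
  calc Real.exp (-(32 * (C : ℝ) ^ 2)) / 30 * 2 ^ m
      ≤ Real.exp (-(8 * (t : ℝ) ^ 2 / ((m / 2 : ℕ) : ℝ))) / 30 * (2 * 4 ^ (m / 2)) := by
        apply mul_le_mul _ hpow (by positivity) (by positivity)
        linarith
    _ = (1 / 15) * Real.exp (-(8 * (t : ℝ) ^ 2 / ((m / 2 : ℕ) : ℝ))) * 4 ^ (m / 2) := by ring
    _ ≤ ∑ j ∈ range (m / 2 - t + 1), ((2 * (m / 2)).choose j : ℝ) := key
    _ ≤ ∑ j ∈ range (m / 2 - t + 1), (m.choose j : ℝ) := hrow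

end Literature.Probability.Moments
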